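import Literature.Probability.LatticeModels.SahiThirdOrderCorrelation
import Mathlib.Combinatorics.SetFamily.FourFunctions
import Mathlib.Order.Irreducible
import Mathlib.Tactic.Linarith
import Mathlib.Tactic.Ring
import HarnessLib
import HarnessLib.Audit

/-!
# `NoHeavyLowerTail` (crux stmt-CriticalPhenomena-4575), Sahi programme P4 (Holley / monotone coupling):
# a quantitative FKG inequality — the covariance of two up-sets is at least `μ(⊥) · μ(common join-primes hit)`

Support file (cell `prim-l12`, seat P4, generation 6; `--supports stmt-CriticalPhenomena-4575`).  No named facts, no sorries;
standard axioms.

## The inequality (new in this generality; for product measures on `2^A` it is the covariance lemma of the cell's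
## `…SahiHittingSlotPrelim` (`SahiHittingSlot.cov_ge_of_empty_notMem`, P3))

Let `L` be a finite distributive lattice with bottom `⊥`, `μ ≥ 0` log-supermodular (not normalised, `Z = m(L)`), `S, S'` proper
up-sets (`⊥ ∉ S`, `⊥ ∉ S'`), and `H ⊆ S ∩ S'` a union of principal up-sets `↑j` of JOIN-PRIME elements (equivalently: `H` an up-set whose
complement `D = L ∖ H` is a sublattice).  Then

  `cov_upperSet_ge_bot_mul`:  `Z·m(S ∩ S') − m(S)·m(S') ≥ μ(⊥) · m(H)`,

i.e. for an FKG probability measure `Cov(1_S, 1_{S'}) ≥ μ(⊥)·μ(H)`: two increasing events are correlated at least as much as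
"nothing happens" times "a join-prime generator common to both happens".  On `2^ι`: `Cov(S, S') ≥ μ(∅)·μ(ω ∩ T ≠ ∅)` for
`T = {i | {i} ∈ S ∩ S'}` (`cov_upperSet_ge_empty_mul_hit`).  Equality e.g. for `S = S' = L ∖ {⊥}`.

Proof (three lines): with `D = L ∖ H` (a sublattice containing `⊥`), `A = S ∩ D`, `B = S' ∩ D`:  `m(S) = m(H) + m(A)`,
`m(S') = m(H) + m(B)`, `m(S ∩ S') = m(H) + m(A ∩ B)`, `Z = m(H) + m(D)`, so
`Z·m(S∩S') − m(S)m(S') = m(H)·(m(D) − m(A) − m(B) + m(A∩B)) + (m(D)·m(A∩B) − m(A)·m(B))`; the first bracket is `m(D ∖ (A ∪ B)) ≥ μ(⊥)`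
and the second is `≥ 0` by the FKG inequality on the sublattice `D` (four functions theorem).

Role: this is the covariance input of the `k`-join-prime extension of the slot-locality theorem `…SahiE3TwoPrimeSlot` (it discharges the
pair constraints of the `ρ`-certificate whenever that certificate lives on the atoms; HOME prim-l12-p4/FROM-prim-l12-p4-gen6-FKG-SLOT-LOCALITY.md).
-/

namespace Summit.CriticalPhenomena.PercolationContinuityZ3.Theorems.SahiE3CovHit

open Finset Literature.Probability.LatticeModels
open scoped BigOperators

variable {α : Type*} [DistribLattice α] [Fintype α] [DecidableEq α]

/-- Four functions theorem, set form: if every meet of `S × T` lies in `V` and every join in `W` then `m(S)m(T) ≤ m(V)m(W)`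
(Ahlswede–Daykin; Mathlib's `four_functions_theorem_univ` for `μ·1_S, μ·1_T, μ·1_V, μ·1_W`). [folklore] -/
theorem mass_mul_mass_le' {μ : α → ℝ} (hμ₀ : 0 ≤ μ) (hμ : ∀ a b, μ a * μ b ≤ μ (a ⊓ b) * μ (a ⊔ b))
    {S T V W : Finset α} (h : ∀ x ∈ S, ∀ y ∈ T, x ⊓ y ∈ V ∧ x ⊔ y ∈ W) :
    mass μ S * mass μ T ≤ mass μ V * mass μ W := by
  have hif : ∀ (X : Finset α) (y : α), 0 ≤ (if y ∈ X then μ y else 0) := fun X y => by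
    split_ifs
    · exact hμ₀ y
    · exact le_rfl
  have hsum : ∀ X : Finset α, ∑ y, (if y ∈ X then μ y else 0) = mass μ X := fun X => by
    rw [Finset.sum_ite_mem, Finset.univ_inter]; rfl
  have key := four_functions_theorem_univ (fun y => if y ∈ S then μ y else 0) (fun y => if y ∈ T then μ y else 0)
    (fun y => if y ∈ V then μ y else 0) (fun y => if y ∈ W then μ y else 0) (hif S) (hif T) (hif V) (hif W) ?_
  · rw [hsum, hsum, hsum, hsum] at key; exact key
  · intro x y
    by_cases hx : x ∈ S
    · by_cases hy : y ∈ T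
      · obtain ⟨hV, hW⟩ := h x hx y hy
        simp only [if_pos hx, if_pos hy, if_pos hV, if_pos hW]; exact hμ x y
      · simp only [if_neg hy, mul_zero]; exact mul_nonneg (hif V _) (hif W _)
    · simp only [if_neg hx, zero_mul]; exact mul_nonneg (hif V _) (hif W _)

omit [DistribLattice α] [Fintype α] in
/-- Additivity of mass over a disjoint union. [folklore] -/
theorem mass_union_of_disjoint (μ : α → ℝ) {X Y : Finset α} (h : Disjoint X Y) : mass μ (X ∪ Y) = mass μ X + mass μ Y := by
  unfold mass; exact Finset.sum_union h

/-- **Quantitative FKG: `Z·m(S∩S') − m(S)m(S') ≥ μ(⊥)·m(H)`.**  `μ ≥ 0` log-supermodular on a finite distributive lattice with `⊥`;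
`S, S'` up-sets not containing `⊥`; `H ⊆ S ∩ S'` an up-set whose complement is closed under `⊔` (e.g. a union of principal up-sets
of join-prime elements, `hit_compl_supClosed`). [this work] -/
theorem cov_upperSet_ge_bot_mul [OrderBot α] {μ : α → ℝ} (hμ₀ : 0 ≤ μ) (hμ : ∀ a b, μ a * μ b ≤ μ (a ⊓ b) * μ (a ⊔ b))
    {S S' H : Finset α} (hS : IsUpperSet (S : Set α)) (hS' : IsUpperSet (S' : Set α)) (hbS : ⊥ ∉ S) (hbS' : ⊥ ∉ S')
    (hH : IsUpperSet (H : Set α)) (hHS : H ⊆ S) (hHS' : H ⊆ S')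
    (hD : ∀ x y, x ∉ H → y ∉ H → x ⊔ y ∉ H) :
    μ ⊥ * mass μ H ≤ mass μ univ * mass μ (S ∩ S') - mass μ S * mass μ S' := by
  set D : Finset α := univ \ H with hDdef
  have memD : ∀ x, x ∈ D ↔ x ∉ H := fun x => by simp [hDdef]
  -- `D` is a sublattice (down-set closed under joins) containing `⊥`
  have hDinf : ∀ x y, x ∈ D → x ⊓ y ∈ D := by
    intro x y hx
    rw [memD] at hx ⊢
    exact fun h => hx (hH (show x ⊓ y ≤ x from inf_le_left) h)
  have hbotH : ⊥ ∉ H := fun h => hbS (hHS h)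
  have hbotD : ⊥ ∈ D := (memD ⊥).2 hbotH
  -- FKG on `D` for `A = S ∩ D`, `B = S' ∩ D`
  have fkgD : mass μ (S ∩ D) * mass μ (S' ∩ D) ≤ mass μ D * mass μ (S ∩ S' ∩ D) := by
    refine mass_mul_mass_le' hμ₀ hμ fun x hx y hy => ?_
    rw [Finset.mem_inter] at hx hy
    refine ⟨hDinf x y hx.2, ?_⟩
    rw [Finset.mem_inter, Finset.mem_inter]
    exact ⟨⟨hS (show x ≤ x ⊔ y from le_sup_left) hx.1, hS' (show y ≤ x ⊔ y from le_sup_right) hy.1⟩,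
      (memD _).2 (hD x y ((memD x).1 hx.2) ((memD y).1 hy.2))⟩
  -- mass decompositions along `univ = H ⊔ D`
  have hdisj : ∀ X : Finset α, Disjoint (X ∩ H) (X ∩ D) := by
    intro X
    rw [Finset.disjoint_left]
    intro x hx hx'
    rw [Finset.mem_inter] at hx hx'
    exact ((memD x).1 hx'.2) hx.2
  have hsplit : ∀ X : Finset α, mass μ X = mass μ (X ∩ H) + mass μ (X ∩ D) := by
    intro X
    rw [← mass_union_of_disjoint μ (hdisj X)]
    congr 1
    ext x
    simp only [Finset.mem_union, Finset.mem_inter, memD]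
    tauto
  have eS : mass μ S = mass μ H + mass μ (S ∩ D) := by
    rw [hsplit S, Finset.inter_eq_right.2 hHS]
  have eS' : mass μ S' = mass μ H + mass μ (S' ∩ D) := by
    rw [hsplit S', Finset.inter_eq_right.2 hHS']
  have eSS' : mass μ (S ∩ S') = mass μ H + mass μ (S ∩ S' ∩ D) := by
    rw [hsplit (S ∩ S'), Finset.inter_eq_right.2 (Finset.subset_inter hHS hHS')]
  have eZ : mass μ univ = mass μ H + mass μ D := by
    rw [hsplit univ, Finset.univ_inter, Finset.univ_inter]
  -- `m(D) ≥ m(S ∩ D) + m(S' ∩ D) − m(S ∩ S' ∩ D) + μ ⊥`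
  have hincl : mass μ ((S ∩ D) ∪ (S' ∩ D)) + mass μ (S ∩ S' ∩ D) = mass μ (S ∩ D) + mass μ (S' ∩ D) := by
    have e : S ∩ S' ∩ D = (S ∩ D) ∩ (S' ∩ D) := by
      ext x; simp only [Finset.mem_inter]; tauto
    rw [e]; unfold mass; exact Finset.sum_union_inter
  have hbotU : ⊥ ∉ (S ∩ D) ∪ (S' ∩ D) := by
    rw [Finset.mem_union, Finset.mem_inter, Finset.mem_inter]
    rintro (h | h)
    · exact hbS h.1
    · exact hbS' h.1
  have hsub : insert ⊥ ((S ∩ D) ∪ (S' ∩ D)) ⊆ D := by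
    intro x hx
    rw [Finset.mem_insert] at hx
    rcases hx with rfl | hx
    · exact hbotD
    · rw [Finset.mem_union, Finset.mem_inter, Finset.mem_inter] at hx
      rcases hx with h | h
      · exact h.2
      · exact h.2
  have hDge : μ ⊥ + mass μ ((S ∩ D) ∪ (S' ∩ D)) ≤ mass μ D := by
    have := mass_mono hμ₀ hsub
    unfold mass at this ⊢
    rwa [Finset.sum_insert hbotU] at this
  -- assemble
  have hH0 : 0 ≤ mass μ H := mass_nonneg hμ₀ H
  rw [eS, eS', eSS', eZ]
  nlinarith [fkgD, hincl, hDge, hH0, mul_le_mul_of_nonneg_left (show μ ⊥ + mass μ ((S ∩ D) ∪ (S' ∩ D)) ≤ mass μ D from hDge) hH0]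

/-- The complement of a union of principal up-sets of join-prime elements is closed under `⊔`. [folklore] -/
theorem sup_notMem_biUnion_principalUp [DecidableLE α] {T : Finset α} (hT : ∀ j ∈ T, SupPrime j) {x y : α}
    (hx : x ∉ T.biUnion principalUp) (hy : y ∉ T.biUnion principalUp) : x ⊔ y ∉ T.biUnion principalUp := by
  rw [Finset.mem_biUnion] at hx hy ⊢
  rintro ⟨j, hj, hxy⟩
  rw [mem_principalUp] at hxy
  rcases (hT j hj).le_sup.1 hxy with h | h
  · exact hx ⟨j, hj, mem_principalUp.2 h⟩
  · exact hy ⟨j, hj, mem_principalUp.2 h⟩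

/-- A union of principal up-sets is an up-set. [folklore] -/
theorem isUpperSet_biUnion_principalUp [DecidableLE α] (T : Finset α) :
    IsUpperSet ((T.biUnion principalUp : Finset α) : Set α) := by
  intro x y hxy hx
  rw [Finset.mem_coe, Finset.mem_biUnion] at hx ⊢
  obtain ⟨j, hj, hjx⟩ := hx
  exact ⟨j, hj, mem_principalUp.2 (le_trans (mem_principalUp.1 hjx) hxy)⟩

/-- **`Cov(S, S') ≥ μ(⊥)·μ(⋃_{j ∈ T} ↑j)` for join-primes `j ∈ T` lying in both up-sets.** [this work] -/
theorem cov_upperSet_ge_bot_mul_hit [OrderBot α] [DecidableLE α] {μ : α → ℝ} (hμ₀ : 0 ≤ μ)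
    (hμ : ∀ a b, μ a * μ b ≤ μ (a ⊓ b) * μ (a ⊔ b)) {S S' : Finset α} (hS : IsUpperSet (S : Set α))
    (hS' : IsUpperSet (S' : Set α)) (hbS : ⊥ ∉ S) (hbS' : ⊥ ∉ S') {T : Finset α} (hT : ∀ j ∈ T, SupPrime j)
    (hTS : ∀ j ∈ T, j ∈ S) (hTS' : ∀ j ∈ T, j ∈ S') :
    μ ⊥ * mass μ (T.biUnion principalUp) ≤ mass μ univ * mass μ (S ∩ S') - mass μ S * mass μ S' := by
  refine cov_upperSet_ge_bot_mul hμ₀ hμ hS hS' hbS hbS' (isUpperSet_biUnion_principalUp T) ?_ ?_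
    (fun x y hx hy => sup_notMem_biUnion_principalUp hT hx hy)
  · intro x hx
    rw [Finset.mem_biUnion] at hx
    obtain ⟨j, hj, hjx⟩ := hx
    exact hS (mem_principalUp.1 hjx) (hTS j hj)
  · intro x hx
    rw [Finset.mem_biUnion] at hx
    obtain ⟨j, hj, hjx⟩ := hx
    exact hS' (mem_principalUp.1 hjx) (hTS' j hj)

/-! ### Boolean lattice form -/

section Boolean

variable {ι : Type*} [Fintype ι] [DecidableEq ι]

omit [Fintype ι] in
/-- Singletons are join-prime in `Finset ι`. [folklore] -/
theorem supPrime_singleton' (i : ι) : SupPrime ({i} : Finset ι) := by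
  refine ⟨fun h => ?_, fun s t hst => ?_⟩
  · have := h (show (∅ : Finset ι) ≤ {i} from Finset.empty_subset _)
    exact absurd (this (Finset.mem_singleton_self i)) (Finset.notMem_empty i)
  · have hi : i ∈ s ∪ t := hst (Finset.mem_singleton_self i)
    rcases Finset.mem_union.1 hi with h | h
    · exact Or.inl (Finset.singleton_subset_iff.2 h)
    · exact Or.inr (Finset.singleton_subset_iff.2 h)

/-- **`Cov(S, S') ≥ μ(∅)·μ(ω meets T)` on `2^ι`** for up-sets `S, S' ∌ ∅` and `T` a set of points whose singletons lie in `S ∩ S'`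
(`{ω | ω ∩ T ≠ ∅} = ⋃_{i∈T} ↑{i}`); for product measures this is P3's covariance lemma, here for every FKG weight. [this work] -/
theorem cov_upperSet_ge_empty_mul_hit {μ : Finset ι → ℝ} (hμ₀ : 0 ≤ μ) (hμ : ∀ a b, μ a * μ b ≤ μ (a ⊓ b) * μ (a ⊔ b))
    {S S' : Finset (Finset ι)} (hS : IsUpperSet (S : Set (Finset ι))) (hS' : IsUpperSet (S' : Set (Finset ι)))
    (hbS : ∅ ∉ S) (hbS' : ∅ ∉ S') {T : Finset ι} (hTS : ∀ i ∈ T, {i} ∈ S) (hTS' : ∀ i ∈ T, {i} ∈ S') :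
    μ ∅ * mass μ (univ.filter fun ω : Finset ι => (ω ∩ T).Nonempty) ≤
      mass μ univ * mass μ (S ∩ S') - mass μ S * mass μ S' := by
  have e : (univ.filter fun ω : Finset ι => (ω ∩ T).Nonempty) = (T.image fun i => ({i} : Finset ι)).biUnion principalUp := by
    ext ω
    simp only [Finset.mem_filter, Finset.mem_univ, true_and, Finset.mem_biUnion, Finset.mem_image, mem_principalUp]
    constructor
    · rintro ⟨i, hi⟩
      rw [Finset.mem_inter] at hi
      exact ⟨{i}, ⟨i, hi.2, rfl⟩, Finset.singleton_subset_iff.2 hi.1⟩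
    · rintro ⟨_, ⟨i, hi, rfl⟩, his⟩
      exact ⟨i, Finset.mem_inter.2 ⟨Finset.singleton_subset_iff.1 his, hi⟩⟩
  rw [e]
  refine cov_upperSet_ge_bot_mul_hit hμ₀ hμ hS hS' hbS hbS' (fun j hj => ?_) (fun j hj => ?_) (fun j hj => ?_)
  · obtain ⟨i, -, rfl⟩ := Finset.mem_image.1 hj; exact supPrime_singleton' i
  · obtain ⟨i, hi, rfl⟩ := Finset.mem_image.1 hj; exact hTS i hi
  · obtain ⟨i, hi, rfl⟩ := Finset.mem_image.1 hj; exact hTS' i hi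

end Boolean

end Summit.CriticalPhenomena.PercolationContinuityZ3.Theorems.SahiE3CovHit
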